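import Summits.Ventures.CertifiedManyBodySolver.Observables.PairLROTowerChargedTwistFlip
import Summits.Ventures.CertifiedManyBodySolver.Observables.PairLROTowerChargedReadingTwisted
import Summits.Ventures.CertifiedManyBodySolver.Observables.PairLROOnePointTwistedFlip
import HarnessLib

/-!
# OP1-C, part 12: the FLIP-TWISTED orbit-state form of the grid theorem and its leaf consumer (the identification
# class of the B0 / E3 / UNION one-point objects)

HONEST FRAMING: first certified bounds on pairing observables; not a superconductivity verdict; a ceiling route,
never presence; nothing in this file is a number. Crew hubbard-obs (D-0042), seat hubbard-obs-p1
(`prover-hubbard-obs-p1-g9-0`); lead RULINGS (eo) d181 / (ex) d190. Zero compute; no definition; no named fact;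
no `sorry`.

An OP1-C claim node exported under the FLIP-TWISTED identification `twistedFlipSpaceGroupUnitary S` (translations
× `D₄` × spin flip with the gauge quarter turn; ONE flip-symmetric total-filling row `μ₀(Re⟨ζ,N̂ζ⟩/L² − ν₀)`, as in
`ObsPairLROCeilingAt_of_onePoint_twistedFlip_orbitState_bound_sq`) carries the charged eom term
`Re ω̄^{twf}_ζ(K_L Γ_L X − Γ_L X K_L)`, `K_L = H_L − μ'N̂`. By PairLROTowerChargedTwistFlip it is the plain charged eom
term of the translation sum of the symmetrised spin-exchanged gauge-conjugated word
`X^{twf}_S = (4|S|)⁻¹ Σ_{γ∈S} Σ_f Σ_m Γ(incl)Γ(d4Emb γ) F^f(𝒢_k X 𝒢_kᴴ) ∈ 𝔄_Ω` (even, even adjoint, operator-norm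
charge `≤ ‖N̂_{Λ'}X − XN̂_{Λ'}‖`), so the grid theorem applies verbatim:

* **`liminf_pairFieldLRO_le_sq_of_onePoint_chargedStationary_twistedFlip_orbitState_bound_TT'_near`** — for EVERY
  nonempty `S ⊆ D₄`, cell datum `μ_c ∈ [μ₋(n), μ₊(n)]`, `|μ' − μ_c| ≤ Δ`, local charge bound `C_q`
  ⇒ `liminf_k u_k ≤ (c − Δ·C_q − A + μ₀(n − ν₀))²`;
* **`ObsPairLROCeilingAt_of_onePoint_charged_twistedFlip_orbitState_bound_sq`** (+ `_reprice`) — the registry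
  consumer at any anchor `(U, n, t′)`, `0 < n < 2`, cap `e₀ ≤ hi ≤ u`.

CONDITIONAL on the claim node and the cell datum fed in; a ceiling never speaks to presence.
References: T. Koma, H. Tasaki, J. Stat. Phys. 76 (1994) 745, Theorem 5 [KomaTasaki1994]; O. Bratteli,
D. W. Robinson, *Operator Algebras and Quantum Statistical Mechanics 2* (1997) §5.2.2, §6.2.4
[BratteliRobinsonII1997]; W. Pusz, S. L. Woronowicz, Comm. Math. Phys. 58 (1978) 273, §1 [PuszWoronowicz1978];
D. Ruelle, *Statistical Mechanics* (1969) §3.4 [Ruelle1969].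
-/

noncomputable section

namespace Summit.Ventures.CertifiedManyBodySolver.Observables

open Matrix Complex Finset Literature.MathematicalPhysics.QuantumLattice Literature.Probability.LatticeModels
open Literature.MathematicalPhysics.QuantumLattice.HubbardWave0 ThermodynamicLimit Filter Topology
open Literature.MathematicalPhysics.QuantumManyBody.StateRelaxation
open Summit.Ventures.CertifiedManyBodySolver.Transport
open scoped ComplexOrder ComplexConjugate BigOperators Matrix.Norms.L2Operator

/-! ### §1  The symmetrised spin-exchanged gauge-conjugated word: evenness, adjoint, charge -/

section Symmetrised

variable {Λ' Ω : Finset (Site 2)} (S : Finset (DihedralGroup 4))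

/-- **The symmetrised spin-exchanged gauge-conjugated word is even** when `X` is. [cite: BratteliRobinsonII1997, §5.2.2] -/
theorem twistedFlipSpaceGroupAverage_mem_carEvenSubalgebra (hsub : ∀ γ ∈ S, d4ShiftSet γ 0 Λ' ⊆ Ω) {X : FermionOp Λ'}
    (hX : X ∈ carEvenSubalgebra (Finset.univ : Finset (Orb (PolySite Λ')))) (a : ℂ) :
    (a • ∑ γ ∈ S.attach, ∑ f : Fin 2, ∑ m : Fin 2, fermionEmbed (PolySite.incl (hsub γ.1 γ.2))
        (fermionEmbed (PolySite.d4Emb γ.1 0 Λ') (spinSwapIter (f : ℕ)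
          (fockGauge (twistFlipExp γ.1 f m) * X * (fockGauge (twistFlipExp γ.1 f m))ᴴ))) : FermionOp Ω) ∈
      carEvenSubalgebra (Finset.univ : Finset (Orb (PolySite Ω))) := by
  refine Subalgebra.smul_mem _ (Subalgebra.sum_mem _ fun γ _ => Subalgebra.sum_mem _ fun f _ =>
    Subalgebra.sum_mem _ fun m _ => ?_) _
  exact carEvenSubalgebra_mono (Finset.subset_univ _) (fermionEmbed_mem_carEvenSubalgebra _
    (carEvenSubalgebra_mono (Finset.subset_univ _) (fermionEmbed_mem_carEvenSubalgebra _
      (spinSwapIter_mem_carEvenSubalgebra _ (fockGauge_conj_mem_carEvenSubalgebra hX _)))))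

/-- The adjoint of the symmetrised word is the symmetrised word of the adjoint. [folklore] -/
theorem conjTranspose_twistedFlipSpaceGroupAverage (hsub : ∀ γ ∈ S, d4ShiftSet γ 0 Λ' ⊆ Ω) (X : FermionOp Λ') (a : ℂ) :
    (a • ∑ γ ∈ S.attach, ∑ f : Fin 2, ∑ m : Fin 2, fermionEmbed (PolySite.incl (hsub γ.1 γ.2))
        (fermionEmbed (PolySite.d4Emb γ.1 0 Λ') (spinSwapIter (f : ℕ)
          (fockGauge (twistFlipExp γ.1 f m) * X * (fockGauge (twistFlipExp γ.1 f m))ᴴ))) : FermionOp Ω)ᴴ =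
      star a • ∑ γ ∈ S.attach, ∑ f : Fin 2, ∑ m : Fin 2, fermionEmbed (PolySite.incl (hsub γ.1 γ.2))
        (fermionEmbed (PolySite.d4Emb γ.1 0 Λ') (spinSwapIter (f : ℕ)
          (fockGauge (twistFlipExp γ.1 f m) * Xᴴ * (fockGauge (twistFlipExp γ.1 f m))ᴴ))) := by
  rw [conjTranspose_smul, conjTranspose_sum]
  refine congrArg _ (Finset.sum_congr rfl fun γ _ => ?_)
  rw [conjTranspose_sum]
  refine Finset.sum_congr rfl fun f _ => ?_
  rw [conjTranspose_sum]
  refine Finset.sum_congr rfl fun m _ => ?_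
  rw [← fermionEmbed_conjTranspose, ← fermionEmbed_conjTranspose, conjTranspose_spinSwapIter,
    conjTranspose_fockGauge_conj]

/-- **The operator-norm charge of the symmetrised word is at most that of `X`.** [cite: BratteliRobinsonII1997, §5.2.2] -/
theorem norm_totalNumberOp_commutator_twistedFlipSpaceGroupAverage_le (hS : S.Nonempty)
    (hsub : ∀ γ ∈ S, d4ShiftSet γ 0 Λ' ⊆ Ω) (X : FermionOp Λ') :
    ‖(totalNumberOp : FermionOp Ω) *
        ((((S.card : ℂ) * 2 * 2))⁻¹ • ∑ γ ∈ S.attach, ∑ f : Fin 2, ∑ m : Fin 2,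
          fermionEmbed (PolySite.incl (hsub γ.1 γ.2)) (fermionEmbed (PolySite.d4Emb γ.1 0 Λ') (spinSwapIter (f : ℕ)
            (fockGauge (twistFlipExp γ.1 f m) * X * (fockGauge (twistFlipExp γ.1 f m))ᴴ)))) -
      ((((S.card : ℂ) * 2 * 2))⁻¹ • ∑ γ ∈ S.attach, ∑ f : Fin 2, ∑ m : Fin 2,
          fermionEmbed (PolySite.incl (hsub γ.1 γ.2)) (fermionEmbed (PolySite.d4Emb γ.1 0 Λ') (spinSwapIter (f : ℕ)
            (fockGauge (twistFlipExp γ.1 f m) * X * (fockGauge (twistFlipExp γ.1 f m))ᴴ)))) * totalNumberOp‖ ≤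
      ‖(totalNumberOp : FermionOp Λ') * X - X * totalNumberOp‖ := by
  have hcardpos : (0 : ℝ) < (S.card : ℝ) * 2 * 2 := by
    have : (0 : ℝ) < (S.card : ℝ) := Nat.cast_pos.2 (Finset.card_pos.2 hS)
    positivity
  set C : FermionOp Λ' := (totalNumberOp : FermionOp Λ') * X - X * totalNumberOp with hC
  have hcomm : (totalNumberOp : FermionOp Ω) *
        ((((S.card : ℂ) * 2 * 2))⁻¹ • ∑ γ ∈ S.attach, ∑ f : Fin 2, ∑ m : Fin 2,
          fermionEmbed (PolySite.incl (hsub γ.1 γ.2)) (fermionEmbed (PolySite.d4Emb γ.1 0 Λ') (spinSwapIter (f : ℕ)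
            (fockGauge (twistFlipExp γ.1 f m) * X * (fockGauge (twistFlipExp γ.1 f m))ᴴ)))) -
      ((((S.card : ℂ) * 2 * 2))⁻¹ • ∑ γ ∈ S.attach, ∑ f : Fin 2, ∑ m : Fin 2,
          fermionEmbed (PolySite.incl (hsub γ.1 γ.2)) (fermionEmbed (PolySite.d4Emb γ.1 0 Λ') (spinSwapIter (f : ℕ)
            (fockGauge (twistFlipExp γ.1 f m) * X * (fockGauge (twistFlipExp γ.1 f m))ᴴ)))) * totalNumberOp =
      (((S.card : ℂ) * 2 * 2))⁻¹ • ∑ γ ∈ S.attach, ∑ f : Fin 2, ∑ m : Fin 2,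
        fermionEmbed (PolySite.incl (hsub γ.1 γ.2)) (fermionEmbed (PolySite.d4Emb γ.1 0 Λ')
          (totalNumberOp * spinSwapIter (f : ℕ)
              (fockGauge (twistFlipExp γ.1 f m) * X * (fockGauge (twistFlipExp γ.1 f m))ᴴ) -
            spinSwapIter (f : ℕ) (fockGauge (twistFlipExp γ.1 f m) * X * (fockGauge (twistFlipExp γ.1 f m))ᴴ) *
              totalNumberOp)) := by
    rw [Matrix.mul_smul, Matrix.smul_mul, ← smul_sub, Finset.mul_sum, Finset.sum_mul, ← Finset.sum_sub_distrib]
    refine congrArg _ (Finset.sum_congr rfl fun γ _ => ?_)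
    rw [Finset.mul_sum, Finset.sum_mul, ← Finset.sum_sub_distrib]
    refine Finset.sum_congr rfl fun f _ => ?_
    rw [Finset.mul_sum, Finset.sum_mul, ← Finset.sum_sub_distrib]
    refine Finset.sum_congr rfl fun m _ => ?_
    rw [totalNumberOp_commutator_fermionEmbed, totalNumberOp_commutator_fermionEmbed]
  rw [hcomm, norm_smul, norm_inv, norm_mul, norm_mul, Complex.norm_natCast, Complex.norm_two]
  calc ((S.card : ℝ) * 2 * 2)⁻¹ * ‖∑ γ ∈ S.attach, ∑ f : Fin 2, ∑ m : Fin 2,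
        fermionEmbed (PolySite.incl (hsub γ.1 γ.2)) (fermionEmbed (PolySite.d4Emb γ.1 0 Λ')
          (totalNumberOp * spinSwapIter (f : ℕ)
              (fockGauge (twistFlipExp γ.1 f m) * X * (fockGauge (twistFlipExp γ.1 f m))ᴴ) -
            spinSwapIter (f : ℕ) (fockGauge (twistFlipExp γ.1 f m) * X * (fockGauge (twistFlipExp γ.1 f m))ᴴ) *
              totalNumberOp))‖
      ≤ ((S.card : ℝ) * 2 * 2)⁻¹ * ∑ _γ ∈ S.attach, ∑ _f : Fin 2, ∑ _m : Fin 2, ‖C‖ := by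
        refine mul_le_mul_of_nonneg_left ((norm_sum_le _ _).trans (Finset.sum_le_sum fun γ _ =>
          (norm_sum_le _ _).trans (Finset.sum_le_sum fun f _ => (norm_sum_le _ _).trans
            (Finset.sum_le_sum fun m _ => ?_)))) (inv_nonneg.2 hcardpos.le)
        exact (norm_fermionEmbed_le _ _).trans ((norm_fermionEmbed_le _ _).trans
          ((norm_totalNumberOp_commutator_spinSwapIter_le _ _).trans
            (norm_totalNumberOp_commutator_fockGauge_conj_le _ X)))
    _ = ‖C‖ := by
        rw [Finset.sum_const, Finset.card_attach, Finset.sum_const, Finset.card_univ, Fintype.card_fin,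
          Finset.sum_const, Finset.card_univ, Fintype.card_fin, smul_smul, smul_smul, nsmul_eq_mul, Nat.cast_mul,
          Nat.cast_mul, Nat.cast_two, ← mul_assoc, inv_mul_cancel₀ hcardpos.ne', one_mul]

end Symmetrised

/-! ### §2  (OP1-C) in FLIP-TWISTED orbit-state form at a grid point ⇒ `liminf u_k ≤ (M + Δ·C_q)²` -/

section Family

/-- **Flip-twisted orbit-state form of OP1-C at a grid chemical potential, sharp constant, `d`-wave form factor,
ONE total-filling row.** Node: for `L ≥ L₁` and unit `ζ`,
`c − A + μ₀(Re⟨ζ,N̂ζ⟩/L² − ν₀) + κ(u − Re⟨ζ,H_Lζ⟩/L²) + Re ω̄^{twf}_ζ(K_L Γ_L X − Γ_L X K_L) ≤ Re ω̄^{twf}_ζ(Γ_L(−Γ(incl)Φ₀))`,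
`K_L = H_L − μ'N̂`, `ω̄^{twf}_ζ = orbitState (twistedFlipSpaceGroupUnitary S) ζ`, any `S ≠ ∅`; data `U ≥ 0`,
`0 < n < 2`, `κ ≥ 0`, `e(t,t',U,n) ≤ u`, `μ_c ∈ [μ₋(n), μ₊(n)]`, `|μ' − μ_c| ≤ Δ`, `X`, `Xᴴ` even,
`‖N̂_{Λ'}X − XN̂_{Λ'}‖ ≤ C_q`. Conclusion: `liminf_k u_k ≤ (c − Δ·C_q − A + μ₀(n − ν₀))²`.
[cite: KomaTasaki1994, Theorem 5] [cite: PuszWoronowicz1978, §1] [cite: BratteliRobinsonII1997, §6.2.4]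
[cite: Ruelle1969, §3.4] -/
theorem liminf_pairFieldLRO_le_sq_of_onePoint_chargedStationary_twistedFlip_orbitState_bound_TT'_near (t t' : ℝ)
    {U n : ℝ} (hU : 0 ≤ U) (hn0 : 0 < n) (hn2 : n < 2) {c A κ u μ₀ ν₀ : ℝ} (hκ : 0 ≤ κ)
    (hu : energyDensityTT' t t' U n ≤ u) {μc μ' Δ Cq : ℝ}
    (hμc : μc ∈ Set.Icc (chemPotMinusTT' t t' U n) (chemPotPlusTT' t t' U n)) (hnear : |μ' - μc| ≤ Δ)
    {S : Finset (DihedralGroup 4)} (hS : S.Nonempty)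
    {Λ' : Finset (Site 2)} (h0 : pairRegion (insert (0 : Site 2) unitSteps) 0 ⊆ Λ')
    (X : FermionOp Λ') (hXeven : X ∈ carEvenSubalgebra (Finset.univ : Finset (Orb (PolySite Λ'))))
    (hXevenH : Xᴴ ∈ carEvenSubalgebra (Finset.univ : Finset (Orb (PolySite Λ'))))
    (hXq : ‖(totalNumberOp : FermionOp Λ') * X - X * totalNumberOp‖ ≤ Cq) (L₁ : ℕ)
    (hInj : ∀ L : ℕ, L₁ ≤ L → Set.InjOn (Torus.proj (d := 2) L) ↑Λ')
    (hbound : ∀ (L : ℕ) [NeZero L] (hL : L₁ ≤ L) (ζ : Fock (Orb (FermionTorus 2 L))), star ζ ⬝ᵥ ζ = 1 →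
      c - A + μ₀ * ((star ζ ⬝ᵥ ((totalNumber : Matrix (Finset (Orb (FermionTorus 2 L))) _ ℂ) *ᵥ ζ)).re /
          (L : ℝ) ^ 2 - ν₀) +
        κ * (u - (star ζ ⬝ᵥ (hubbardTorusTT' L t t' U *ᵥ ζ)).re / (L : ℝ) ^ 2) +
        (orbitState (twistedFlipSpaceGroupUnitary S) ζ
          ((hubbardTorusTT' L t t' U - (μ' : ℂ) • totalNumber) * fermionEmbed (PolySite.toTorusEmb L (hInj L hL)) X -
            fermionEmbed (PolySite.toTorusEmb L (hInj L hL)) X *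
              (hubbardTorusTT' L t t' U - (μ' : ℂ) • totalNumber))).re ≤
        (orbitState (twistedFlipSpaceGroupUnitary S) ζ (fermionEmbed (PolySite.toTorusEmb L (hInj L hL))
          (-(fermionEmbed (PolySite.incl h0) (localPairAt (insert (0 : Site 2) unitSteps) dWaveFormFactor 0))))).re)
    (ψ : ∀ L, Fock (Orb (FermionTorus 2 L)))
    (hψ : ∀ L, IsGroundStateInSector (hubbardTorusTT' L t t' U) (rectN n L) 0 (ψ L))
    (hψ1 : ∀ L, star (ψ L) ⬝ᵥ ψ L = 1) :
    liminf (fun k : ℕ => (∑ x ∈ halfOpenBox 2 (2 * k), ∑ y ∈ halfOpenBox 2 (2 * k),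
        torusPullback (pairFieldCorr dWaveFormFactor ψ) (2 * k) x y) / ((#(halfOpenBox 2 (2 * k)) : ℝ)) ^ 2) atTop ≤
      (c - Δ * Cq - A + μ₀ * (n - ν₀)) ^ 2 := by
  -- the symmetrised spin-exchanged gauge-conjugated eom word on `Ω = ⋃_γ γΛ'`
  set Ω : Finset (Site 2) := S.biUnion (fun γ => d4ShiftSet γ 0 Λ') with hΩdef
  have hsub : ∀ γ ∈ S, d4ShiftSet γ 0 Λ' ⊆ Ω := fun γ hγ =>
    Finset.subset_biUnion_of_mem (fun γ => d4ShiftSet γ 0 Λ') hγ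
  set XS : FermionOp Ω := (((S.card : ℂ) * 2 * 2))⁻¹ •
    ∑ γ ∈ S.attach, ∑ f : Fin 2, ∑ m : Fin 2, fermionEmbed (PolySite.incl (hsub γ.1 γ.2))
      (fermionEmbed (PolySite.d4Emb γ.1 0 Λ') (spinSwapIter (f : ℕ)
        (fockGauge (twistFlipExp γ.1 f m) * X * (fockGauge (twistFlipExp γ.1 f m))ᴴ))) with hXS
  have hXSeven : XS ∈ carEvenSubalgebra (Finset.univ : Finset (Orb (PolySite Ω))) :=
    twistedFlipSpaceGroupAverage_mem_carEvenSubalgebra S hsub hXeven _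
  have hXSevenH : XSᴴ ∈ carEvenSubalgebra (Finset.univ : Finset (Orb (PolySite Ω))) := by
    rw [hXS, conjTranspose_twistedFlipSpaceGroupAverage S hsub X]
    exact twistedFlipSpaceGroupAverage_mem_carEvenSubalgebra S hsub hXevenH _
  have hXSq : ‖(totalNumberOp : FermionOp Ω) * XS - XS * totalNumberOp‖ ≤ Cq :=
    (norm_totalNumberOp_commutator_twistedFlipSpaceGroupAverage_le S hS hsub X).trans hXq
  obtain ⟨DN, LN, hDN, hDD₁, hDD₂⟩ := exists_abs_re_doubleCommutator_totalNumber_le_hermitianParts XS hXSeven hXSevenH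
  obtain ⟨LΩ, hLΩ⟩ := exists_forall_le_injOn_proj (d := 2) Ω
  have hInjΩ : ∀ L : ℕ, max L₁ LΩ ≤ L → Set.InjOn (Torus.proj (d := 2) L) ↑Ω :=
    fun L hL => hLΩ L (le_trans (le_max_right _ _) hL)
  have hsq : (c - Δ * Cq - A + (∑ _σ : Fin 2, μ₀) * (n / 2 - ν₀ / 2)) ^ 2 = (c - Δ * Cq - A + μ₀ * (n - ν₀)) ^ 2 := by
    rw [Fin.sum_univ_two, show (μ₀ + μ₀) * (n / 2 - ν₀ / 2) = μ₀ * (n - ν₀) by ring]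
  rw [← hsq]
  refine liminf_pairFieldLRO_le_sq_of_onePoint_chargedStationary_bound_TT'_near dWaveFormFactor t t' hU hn0 hn2
    (fun _ => μ₀) hκ hu hμc hnear XS hXSeven hXSevenH (max L₁ LΩ) hInjΩ LN hDN
    (fun L _ hL hLN χ hχ => hDD₁ L hLN (hInjΩ L hL) χ hχ)
    (fun L _ hL hLN χ hχ => hDD₂ L hLN (hInjΩ L hL) χ hχ) ?_ ?_ ψ hψ hψ1
  · -- `hWq` in operator-norm form
    intro L _ hL ζ hζ
    exact (abs_re_expect_totalNumber_commutator_translationSum_le_opNorm (hInjΩ L hL) XS ζ hζ).trans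
      (mul_le_mul_of_nonneg_right hXSq (by positivity))
  · -- the node
    intro L _ hL ζ hζ
    have hL₁ : L₁ ≤ L := le_trans (le_max_left _ _) hL
    have hcardS : ((S.card : ℂ) * 2 * 2) ≠ 0 :=
      mul_ne_zero (mul_ne_zero (Nat.cast_ne_zero.2 (Finset.card_pos.2 hS).ne') two_ne_zero) two_ne_zero
    have hcardT : (Fintype.card (TorusSite 2 L) : ℂ) = (((L : ℝ) ^ 2 : ℝ) : ℂ) := by
      have hc : Fintype.card (TorusSite 2 L) = L ^ 2 := by simp [ZMod.card, Fintype.card_fin]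
      rw [hc]; push_cast; ring
    set K : Matrix (Finset (Orb (FermionTorus 2 L))) (Finset (Orb (FermionTorus 2 L))) ℂ :=
      hubbardTorusTT' L t t' U - (μ' : ℂ) • totalNumber with hK
    have hKD : ∀ γ : DihedralGroup 4, relabel (Orb.d4Perm (L := L) γ) K = K := fun γ =>
      relabel_d4Perm_hubbardTorusTT'_sub_smul_totalNumber γ t t' U _
    have hKT : ∀ v : TorusSite 2 L, relabel (Orb.translate v) K = K := fun v =>
      relabel_translate_hubbardTorusTT'_sub_smul_totalNumber v t t' U _
    have hKN : Commute totalNumberOp K := by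
      rw [hK, totalNumberOp_eq_totalNumber]
      exact ((hubbardTorusTT'_commute_totalNumber L t t' U).symm).sub_right ((Commute.refl _).smul_right _)
    have hKF : Commute fockSpinFlip K :=
      (fockSpinFlip_commute_hubbardTorusTT' t t' U).sub_right ((fockSpinFlip_commute_totalNumber).smul_right _)
    have hW : ∑ v : TorusSite 2 L, relabel (Orb.translate v) (fermionEmbed (PolySite.toTorusEmb L (hInjΩ L hL)) XS) =
        (((S.card : ℂ) * 2 * 2))⁻¹ • ∑ γ ∈ S, ∑ f : Fin 2, ∑ m : Fin 2, (∑ v : TorusSite 2 L,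
          relabel (Orb.translate v)
          (fermionEmbed (PolySite.toTorusEmb L ((injOn_proj_d4ShiftSet_iff L γ 0 Λ').2 (hInj L hL₁)))
            (fermionEmbed (PolySite.d4Emb γ 0 Λ') (spinSwapIter (f : ℕ)
              (fockGauge (twistFlipExp γ f m) * X * (fockGauge (twistFlipExp γ f m))ᴴ))))) := by
      rw [sum_translate_twistedFlipSpaceGroupAverage_eq S (hInj L hL₁) (hInjΩ L hL) hsub X, hXS]
      simp_rw [fermionEmbed_smul, relabel_smul]
      rw [← Finset.smul_sum]
    have hsumexp : ∑ γ ∈ S, ∑ f : Fin 2, ∑ m : Fin 2, expect (K *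
        (∑ v : TorusSite 2 L, relabel (Orb.translate v)
          (fermionEmbed (PolySite.toTorusEmb L ((injOn_proj_d4ShiftSet_iff L γ 0 Λ').2 (hInj L hL₁)))
            (fermionEmbed (PolySite.d4Emb γ 0 Λ') (spinSwapIter (f : ℕ)
              (fockGauge (twistFlipExp γ f m) * X * (fockGauge (twistFlipExp γ f m))ᴴ))))) -
        (∑ v : TorusSite 2 L, relabel (Orb.translate v)
          (fermionEmbed (PolySite.toTorusEmb L ((injOn_proj_d4ShiftSet_iff L γ 0 Λ').2 (hInj L hL₁)))
            (fermionEmbed (PolySite.d4Emb γ 0 Λ') (spinSwapIter (f : ℕ)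
              (fockGauge (twistFlipExp γ f m) * X * (fockGauge (twistFlipExp γ f m))ᴴ))))) * K) ζ =
        ((S.card : ℂ) * 2 * 2) * expect (K *
          (∑ v : TorusSite 2 L, relabel (Orb.translate v) (fermionEmbed (PolySite.toTorusEmb L (hInjΩ L hL)) XS)) -
          (∑ v : TorusSite 2 L, relabel (Orb.translate v) (fermionEmbed (PolySite.toTorusEmb L (hInjΩ L hL)) XS)) *
            K) ζ := by
      rw [hW, Matrix.mul_smul, Matrix.smul_mul, ← smul_sub, Finset.mul_sum, Finset.sum_mul, ← Finset.sum_sub_distrib]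
      unfold Literature.MathematicalPhysics.QuantumLattice.expect
      rw [smul_mulVec, dotProduct_smul, smul_eq_mul, ← mul_assoc, mul_inv_cancel₀ hcardS, one_mul,
        Matrix.sum_mulVec, dotProduct_sum]
      refine Finset.sum_congr rfl fun γ _ => ?_
      rw [Finset.mul_sum, Finset.sum_mul, ← Finset.sum_sub_distrib, Matrix.sum_mulVec, dotProduct_sum]
      refine Finset.sum_congr rfl fun f _ => ?_
      rw [Finset.mul_sum, Finset.sum_mul, ← Finset.sum_sub_distrib, Matrix.sum_mulVec, dotProduct_sum]
    have heom : (orbitState (twistedFlipSpaceGroupUnitary S) ζ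
        (K * fermionEmbed (PolySite.toTorusEmb L (hInj L hL₁)) X -
          fermionEmbed (PolySite.toTorusEmb L (hInj L hL₁)) X * K)).re =
        (star ζ ⬝ᵥ ((K *
          (∑ v : TorusSite 2 L, relabel (Orb.translate v) (fermionEmbed (PolySite.toTorusEmb L (hInjΩ L hL)) XS)) -
          (∑ v : TorusSite 2 L, relabel (Orb.translate v) (fermionEmbed (PolySite.toTorusEmb L (hInjΩ L hL)) XS)) *
            K) *ᵥ ζ)).re / (L : ℝ) ^ 2 := by
      rw [orbitState_twistedFlipSpaceGroupUnitary_commutator_fermionEmbed_of_invariant S K hKD hKT hKN hKF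
        (hInj L hL₁) X ζ]
      simp_rw [← Finset.mul_sum]
      rw [hsumexp, mul_left_comm, inv_mul_cancel_left₀ hcardS, hcardT, ← Complex.ofReal_inv,
        Complex.re_ofReal_mul, inv_mul_eq_div]
      rfl
    have h := hbound L hL₁ ζ hζ
    rw [fermionEmbed_neg, map_neg, Complex.neg_re,
      re_orbitState_twistedFlipSpaceGroupUnitary_localPairAt hS h0 (hInj L hL₁) ζ, heom,
      ← sum_spin_filling_eq_total ζ μ₀ ν₀] at h
    exact h

end Family

/-! ### §3  The registry consumer for FLIP-TWISTED OP1-C nodes at ANY anchor `(U, n, t′)` -/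

section Consumer

variable {tp U n : ℝ} {hi c' : ℚ} {c A κ u μ₀ ν₀ μc μ' Δ Cq : ℝ}

/-- **Flip-twisted OP1-C orbit-state node at `(U, n, t′)` ⇒ the pair-LRO ceiling leaf at `(M + Δ·C_q)²`**,
`M = −(c − A + μ₀(n − ν₀))`. As `ObsPairLROCeilingAt_of_onePoint_twistedFlip_orbitState_bound_sq`
(PairLROOnePointTwistedFlip: ONE total-filling row, any `S ≠ ∅`) PLUS the charged eom term at the grid chemical
potential `μ'`, the word `X` (`X`, `Xᴴ` even, `‖N̂_{Λ'}X − XN̂_{Λ'}‖ ≤ C_q`) and the cell datum `μ_c ∈ [μ₋(n), μ₊(n)]`,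
`|μ' − μ_c| ≤ Δ`; requires `0 < n`. CONDITIONAL ON THE CLAIM NODE and the cell datum.
[cite: KomaTasaki1994, Theorem 5] [cite: Ruelle1969, §3.4] -/
theorem ObsPairLROCeilingAt_of_onePoint_charged_twistedFlip_orbitState_bound_sq (hU : 0 ≤ U) (hn0 : 0 < n)
    (hn2 : n < 2) (hκ : 0 ≤ κ) (hE : energyDensityTT' 1 tp U n ≤ ((hi : ℚ) : ℝ)) (hhi : ((hi : ℚ) : ℝ) ≤ u)
    (hμc : μc ∈ Set.Icc (chemPotMinusTT' 1 tp U n) (chemPotPlusTT' 1 tp U n)) (hnear : |μ' - μc| ≤ Δ)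
    {S : Finset (DihedralGroup 4)} (hS : S.Nonempty)
    {Λ' : Finset (Site 2)} (h0 : pairRegion (insert (0 : Site 2) unitSteps) 0 ⊆ Λ')
    (X : FermionOp Λ') (hXeven : X ∈ carEvenSubalgebra (Finset.univ : Finset (Orb (PolySite Λ'))))
    (hXevenH : Xᴴ ∈ carEvenSubalgebra (Finset.univ : Finset (Orb (PolySite Λ'))))
    (hXq : ‖(totalNumberOp : FermionOp Λ') * X - X * totalNumberOp‖ ≤ Cq) (L₁ : ℕ)
    (hInj : ∀ L : ℕ, L₁ ≤ L → Set.InjOn (Torus.proj (d := 2) L) ↑Λ')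
    (hbound : ∀ (L : ℕ) [NeZero L] (hL : L₁ ≤ L) (ζ : Fock (Orb (FermionTorus 2 L))), star ζ ⬝ᵥ ζ = 1 →
      c - A + μ₀ * ((star ζ ⬝ᵥ ((totalNumber : Matrix (Finset (Orb (FermionTorus 2 L))) _ ℂ) *ᵥ ζ)).re /
          (L : ℝ) ^ 2 - ν₀) +
        κ * (u - (star ζ ⬝ᵥ (hubbardTorusTT' L 1 tp U *ᵥ ζ)).re / (L : ℝ) ^ 2) +
        (orbitState (twistedFlipSpaceGroupUnitary S) ζ
          ((hubbardTorusTT' L 1 tp U - (μ' : ℂ) • totalNumber) * fermionEmbed (PolySite.toTorusEmb L (hInj L hL)) X -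
            fermionEmbed (PolySite.toTorusEmb L (hInj L hL)) X *
              (hubbardTorusTT' L 1 tp U - (μ' : ℂ) • totalNumber))).re ≤
        (orbitState (twistedFlipSpaceGroupUnitary S) ζ (fermionEmbed (PolySite.toTorusEmb L (hInj L hL))
          (-(fermionEmbed (PolySite.incl h0)
            (localPairAt (insert (0 : Site 2) unitSteps) dWaveFormFactor 0))))).re)
    (hc' : (c - Δ * Cq - A + μ₀ * (n - ν₀)) ^ 2 ≤ ((c' : ℚ) : ℝ)) :
    ObsPairLROCeilingAt tp U n c' := by
  intro ψ hψ hψ1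
  exact (liminf_pairFieldLRO_le_sq_of_onePoint_chargedStationary_twistedFlip_orbitState_bound_TT'_near 1 tp hU
    hn0 hn2 hκ (hE.trans hhi) hμc hnear hS h0 X hXeven hXevenH hXq L₁ hInj hbound ψ hψ hψ1).trans hc'

/-- **THE ONE-POINT FAST LAYER for flip-twisted OP1-C nodes.** The same node read under ANY certified cap
`e₀ ≤ hi` gives the leaf at every `c' ≥ (c − Δ·C_q − A + μ₀(n − ν₀) + κ(u − hi))²`. [cite: KomaTasaki1994, Theorem 5] -/
theorem ObsPairLROCeilingAt_of_onePoint_charged_twistedFlip_orbitState_bound_sq_reprice (hU : 0 ≤ U)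
    (hn0 : 0 < n) (hn2 : n < 2) (hκ : 0 ≤ κ) (hE : energyDensityTT' 1 tp U n ≤ ((hi : ℚ) : ℝ))
    (hμc : μc ∈ Set.Icc (chemPotMinusTT' 1 tp U n) (chemPotPlusTT' 1 tp U n)) (hnear : |μ' - μc| ≤ Δ)
    {S : Finset (DihedralGroup 4)} (hS : S.Nonempty)
    {Λ' : Finset (Site 2)} (h0 : pairRegion (insert (0 : Site 2) unitSteps) 0 ⊆ Λ')
    (X : FermionOp Λ') (hXeven : X ∈ carEvenSubalgebra (Finset.univ : Finset (Orb (PolySite Λ'))))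
    (hXevenH : Xᴴ ∈ carEvenSubalgebra (Finset.univ : Finset (Orb (PolySite Λ'))))
    (hXq : ‖(totalNumberOp : FermionOp Λ') * X - X * totalNumberOp‖ ≤ Cq) (L₁ : ℕ)
    (hInj : ∀ L : ℕ, L₁ ≤ L → Set.InjOn (Torus.proj (d := 2) L) ↑Λ')
    (hbound : ∀ (L : ℕ) [NeZero L] (hL : L₁ ≤ L) (ζ : Fock (Orb (FermionTorus 2 L))), star ζ ⬝ᵥ ζ = 1 →
      c - A + μ₀ * ((star ζ ⬝ᵥ ((totalNumber : Matrix (Finset (Orb (FermionTorus 2 L))) _ ℂ) *ᵥ ζ)).re /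
          (L : ℝ) ^ 2 - ν₀) +
        κ * (u - (star ζ ⬝ᵥ (hubbardTorusTT' L 1 tp U *ᵥ ζ)).re / (L : ℝ) ^ 2) +
        (orbitState (twistedFlipSpaceGroupUnitary S) ζ
          ((hubbardTorusTT' L 1 tp U - (μ' : ℂ) • totalNumber) * fermionEmbed (PolySite.toTorusEmb L (hInj L hL)) X -
            fermionEmbed (PolySite.toTorusEmb L (hInj L hL)) X *
              (hubbardTorusTT' L 1 tp U - (μ' : ℂ) • totalNumber))).re ≤
        (orbitState (twistedFlipSpaceGroupUnitary S) ζ (fermionEmbed (PolySite.toTorusEmb L (hInj L hL))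
          (-(fermionEmbed (PolySite.incl h0)
            (localPairAt (insert (0 : Site 2) unitSteps) dWaveFormFactor 0))))).re)
    (hc' : (c - Δ * Cq - A + μ₀ * (n - ν₀) + κ * (u - ((hi : ℚ) : ℝ))) ^ 2 ≤ ((c' : ℚ) : ℝ)) :
    ObsPairLROCeilingAt tp U n c' := by
  have hc'' : (c + κ * (u - ((hi : ℚ) : ℝ)) - Δ * Cq - A + μ₀ * (n - ν₀)) ^ 2 ≤ ((c' : ℚ) : ℝ) := by
    have : c + κ * (u - ((hi : ℚ) : ℝ)) - Δ * Cq - A + μ₀ * (n - ν₀) =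
        c - Δ * Cq - A + μ₀ * (n - ν₀) + κ * (u - ((hi : ℚ) : ℝ)) := by ring
    rw [this]; exact hc'
  refine ObsPairLROCeilingAt_of_onePoint_charged_twistedFlip_orbitState_bound_sq (c := c + κ * (u - ((hi : ℚ) : ℝ)))
    (u := ((hi : ℚ) : ℝ)) hU hn0 hn2 hκ hE le_rfl hμc hnear hS h0 X hXeven hXevenH hXq L₁ hInj ?_ hc''
  intro L _ hL ζ hζ
  convert hbound L hL ζ hζ using 1
  ring

end Consumer

end Summit.Ventures.CertifiedManyBodySolver.Observables

end
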